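import Mathlib
import Summits.Ventures.PercRepro2.RowC1Min

/-!
# The sharpened three-covariance inequality (TRI-COV) and its reduction of row 2′C1
(blind cell PercRepro2, p2 g28; proofs/P2-G28-C1.md §4)

With `Q = {a₁ ↮ a₂}`, `C₁ = C(a₁)`, `C₂ = C(a₂)`, `U = C₁ ∪ C₂` and `μ = P(· | Q)`, the seat's
sharpened conjecture is

  **(TRI-COV)**  `Cov_μ(1[b ∈ U], 1[o ∈ C₁]) + Cov_μ(1[b ∈ C₂], 1[o ∈ C₂]) ≥ 0`,

cleared by `P(Q)²`: `P(Q)·(P(Q, b ∈ U, o ∈ C₁) + P(Q, b ∈ C₂, o ∈ C₂)) ≥ P(Q, b ∈ U)·P(Q, o ∈ C₁) + P(Q, b ∈ C₂)·P(Q, o ∈ C₂)`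
(`TriCov`).  Equivalently `R ≤ A₁ + A₂`: the BHK06-1.4 repulsion `R = μ(b∈C₂)μ(o∈C₁) − μ(b∈C₂, o∈C₁)`
is at most the sum of the two BHK06-1.3 same-cluster attractions `A_i = Cov_μ(1[b ∈ C_i], 1[o ∈ C_i])`.
It is census-true (own descents, exact re-check; proofs/P2-G28-C1.md §4) and it implies row 2′C1:

* `e1_of_triCov`: `Cov_μ(1[b ∈ C₂], 1[o ∈ U]) ≥ −μ(b ∈ C₁, o ∈ C₁)` (cleared);
* `c1_of_triCov`: **(c1)** `P(Q, b ∈ C₂)·P(Q, o ∈ U) ≤ P(Q)·P(Q, o ∈ U, b ∈ U)`;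
* `c1m_of_triCov`: the mirror (c1m) from `TriCov` with the marks `o, b` exchanged.

Proof of the reduction: `P(Q, o ∈ U, b ∈ U) ≥ P(Q, b ∈ U, o ∈ C₁) + P(Q, b ∈ C₂, o ∈ C₂)` (the two events are
disjoint on `Q`), then (TRI-COV), then `P(Q, b ∈ U) ≥ P(Q, b ∈ C₂)` and `P(Q, o ∈ U) = P(Q, o ∈ C₁) + P(Q, o ∈ C₂)`.
No probabilistic input beyond the stated hypothesis; `TriCov` itself is NOT proved here.
-/

namespace Summit.Ventures.PercRepro2

namespace RowC1

section Tri

variable {V : Type*} {E : Type*} [Fintype E] [DecidableEq E]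
  {R : Type*} [CommRing R] [LinearOrder R] [IsStrictOrderedRing R]

/-- **(TRI-COV)**, cleared by `P(Q)²`: `P(Q)·(P(Q, b ∈ U, o ∈ C₁) + P(Q, b ∈ C₂, o ∈ C₂)) ≥
P(Q, b ∈ U)·P(Q, o ∈ C₁) + P(Q, b ∈ C₂)·P(Q, o ∈ C₂)`, i.e. `Cov_μ(1[b∈U], 1[o∈C₁]) + Cov_μ(1[b∈C₂], 1[o∈C₂]) ≥ 0`
under `μ = P(· | a₁ ↮ a₂)`.  A CONJECTURE of the cell (p2 g28), not a fact. -/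
def TriCov (p : E → R) (ends : E → Sym2 V) (a₁ a₂ o b : V) : Prop :=
  prob p (connEvent ends a₁ b ∩ (connEvent ends a₁ a₂)ᶜ ∪ connEvent ends a₂ b ∩ (connEvent ends a₁ a₂)ᶜ) *
      prob p (connEvent ends a₁ o ∩ (connEvent ends a₁ a₂)ᶜ) +
    prob p (connEvent ends a₂ b ∩ (connEvent ends a₁ a₂)ᶜ) *
      prob p (connEvent ends a₂ o ∩ (connEvent ends a₁ a₂)ᶜ) ≤
  prob p (connEvent ends a₁ a₂)ᶜ *
    (prob p ((connEvent ends a₁ b ∪ connEvent ends a₂ b) ∩ connEvent ends a₁ o ∩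
        (connEvent ends a₁ a₂)ᶜ) +
      prob p (connEvent ends a₂ b ∩ connEvent ends a₂ o ∩ (connEvent ends a₁ a₂)ᶜ))

/-- `{b ∈ U} ∩ {o ∈ C₁} ∩ Q` and `{b ∈ C₂} ∩ {o ∈ C₂} ∩ Q` are disjoint (on `Q`, `o` is not in both
clusters) and both lie in `{o ∈ U} ∩ {b ∈ U} ∩ Q`. -/
lemma tri_pieces_le (p : E → R) (hp : IsProbVec p) (ends : E → Sym2 V) (a₁ a₂ o b : V) :
    prob p ((connEvent ends a₁ b ∪ connEvent ends a₂ b) ∩ connEvent ends a₁ o ∩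
        (connEvent ends a₁ a₂)ᶜ) +
      prob p (connEvent ends a₂ b ∩ connEvent ends a₂ o ∩ (connEvent ends a₁ a₂)ᶜ) ≤
    prob p ((connEvent ends a₁ o ∪ connEvent ends a₂ o) ∩
      (connEvent ends a₁ b ∪ connEvent ends a₂ b) ∩ (connEvent ends a₁ a₂)ᶜ) := by
  have hdisj : Disjoint ((connEvent ends a₁ b ∪ connEvent ends a₂ b) ∩ connEvent ends a₁ o ∩
      (connEvent ends a₁ a₂)ᶜ) (connEvent ends a₂ b ∩ connEvent ends a₂ o ∩ (connEvent ends a₁ a₂)ᶜ) := by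
    rw [Set.disjoint_left]
    rintro ω ⟨⟨-, ho1⟩, hQ⟩ ⟨⟨-, ho2⟩, -⟩
    exact hQ (conn_trans ho1 (conn_symm ho2))
  rw [← prob_union_of_disjoint p hdisj]
  refine prob_mono hp ?_
  rintro ω (⟨⟨hb, ho⟩, hQ⟩ | ⟨⟨hb, ho⟩, hQ⟩)
  · exact ⟨⟨Or.inl ho, hb⟩, hQ⟩
  · exact ⟨⟨Or.inr ho, Or.inr hb⟩, hQ⟩

/-- **Row 2′C1 from (TRI-COV)**: `TriCov` at the marks `(o, b)` gives
`P(Q, b ∈ C₂)·P(Q, o ∈ U) ≤ P(Q)·P(Q, o ∈ U, b ∈ U)`. -/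
theorem c1_of_triCov (p : E → R) (hp : IsProbVec p) (ends : E → Sym2 V) (a₁ a₂ o b : V)
    (h : TriCov p ends a₁ a₂ o b) :
    prob p (connEvent ends a₂ b ∩ (connEvent ends a₁ a₂)ᶜ) *
      prob p ((connEvent ends a₁ o ∪ connEvent ends a₂ o) ∩ (connEvent ends a₁ a₂)ᶜ) ≤
    prob p (connEvent ends a₁ a₂)ᶜ *
      prob p ((connEvent ends a₁ o ∪ connEvent ends a₂ o) ∩
        (connEvent ends a₁ b ∪ connEvent ends a₂ b) ∩ (connEvent ends a₁ a₂)ᶜ) := by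
  unfold TriCov at h
  have hpieces := tri_pieces_le p hp ends a₁ a₂ o b
  have hbU : prob p (connEvent ends a₂ b ∩ (connEvent ends a₁ a₂)ᶜ) ≤
      prob p (connEvent ends a₁ b ∩ (connEvent ends a₁ a₂)ᶜ ∪
        connEvent ends a₂ b ∩ (connEvent ends a₁ a₂)ᶜ) :=
    prob_mono hp Set.subset_union_right
  have h0oL := prob_nonneg hp (connEvent ends a₁ o ∩ (connEvent ends a₁ a₂)ᶜ)
  have h0Q := prob_nonneg hp (connEvent ends a₁ a₂)ᶜ
  rw [prob_union_inter_Q p ends a₁ a₂ o, mul_add]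
  calc prob p (connEvent ends a₂ b ∩ (connEvent ends a₁ a₂)ᶜ) *
          prob p (connEvent ends a₁ o ∩ (connEvent ends a₁ a₂)ᶜ) +
        prob p (connEvent ends a₂ b ∩ (connEvent ends a₁ a₂)ᶜ) *
          prob p (connEvent ends a₂ o ∩ (connEvent ends a₁ a₂)ᶜ)
      ≤ prob p (connEvent ends a₁ b ∩ (connEvent ends a₁ a₂)ᶜ ∪
            connEvent ends a₂ b ∩ (connEvent ends a₁ a₂)ᶜ) *
          prob p (connEvent ends a₁ o ∩ (connEvent ends a₁ a₂)ᶜ) +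
        prob p (connEvent ends a₂ b ∩ (connEvent ends a₁ a₂)ᶜ) *
          prob p (connEvent ends a₂ o ∩ (connEvent ends a₁ a₂)ᶜ) :=
        add_le_add (mul_le_mul_of_nonneg_right hbU h0oL) le_rfl
    _ ≤ prob p (connEvent ends a₁ a₂)ᶜ *
          (prob p ((connEvent ends a₁ b ∪ connEvent ends a₂ b) ∩ connEvent ends a₁ o ∩
              (connEvent ends a₁ a₂)ᶜ) +
            prob p (connEvent ends a₂ b ∩ connEvent ends a₂ o ∩ (connEvent ends a₁ a₂)ᶜ)) := h
    _ ≤ prob p (connEvent ends a₁ a₂)ᶜ *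
          prob p ((connEvent ends a₁ o ∪ connEvent ends a₂ o) ∩
            (connEvent ends a₁ b ∪ connEvent ends a₂ b) ∩ (connEvent ends a₁ a₂)ᶜ) :=
        mul_le_mul_of_nonneg_left hpieces h0Q

/-- **The mirror (c1m) from (TRI-COV) at the marks `(b, o)`**:
`P(Q, o ∈ C₂)·P(Q, b ∈ U) ≤ P(Q)·P(Q, o ∈ U, b ∈ U)`. -/
theorem c1m_of_triCov (p : E → R) (hp : IsProbVec p) (ends : E → Sym2 V) (a₁ a₂ o b : V)
    (h : TriCov p ends a₁ a₂ b o) :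
    prob p (connEvent ends a₂ o ∩ (connEvent ends a₁ a₂)ᶜ) *
      prob p ((connEvent ends a₁ b ∪ connEvent ends a₂ b) ∩ (connEvent ends a₁ a₂)ᶜ) ≤
    prob p (connEvent ends a₁ a₂)ᶜ *
      prob p ((connEvent ends a₁ o ∪ connEvent ends a₂ o) ∩
        (connEvent ends a₁ b ∪ connEvent ends a₂ b) ∩ (connEvent ends a₁ a₂)ᶜ) := by
  have := c1_of_triCov p hp ends a₁ a₂ b o h
  rwa [Set.inter_comm (connEvent ends a₁ b ∪ connEvent ends a₂ b)
    (connEvent ends a₁ o ∪ connEvent ends a₂ o)] at this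

/-- **(E1) from (TRI-COV)**: `P(Q, b ∈ C₂)·P(Q, o ∈ U) ≤ P(Q)·(P(Q, b ∈ C₂, o ∈ U) + P(Q, b ∈ C₁, o ∈ C₁))`,
i.e. `Cov_μ(1[b ∈ C₂], 1[o ∈ U]) ≥ −μ(b ∈ C₁, o ∈ C₁)` — the intermediate statement between (TRI-COV) and (c1). -/
theorem e1_of_triCov (p : E → R) (hp : IsProbVec p) (ends : E → Sym2 V) (a₁ a₂ o b : V)
    (h : TriCov p ends a₁ a₂ o b) :
    prob p (connEvent ends a₂ b ∩ (connEvent ends a₁ a₂)ᶜ) *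
      prob p ((connEvent ends a₁ o ∪ connEvent ends a₂ o) ∩ (connEvent ends a₁ a₂)ᶜ) ≤
    prob p (connEvent ends a₁ a₂)ᶜ *
      (prob p (connEvent ends a₂ b ∩ (connEvent ends a₁ o ∪ connEvent ends a₂ o) ∩
          (connEvent ends a₁ a₂)ᶜ) +
        prob p (connEvent ends a₁ b ∩ connEvent ends a₁ o ∩ (connEvent ends a₁ a₂)ᶜ)) := by
  unfold TriCov at h
  -- `P(Q, b ∈ U, o ∈ C₁) = P(Q, b ∈ C₁, o ∈ C₁) + P(Q, b ∈ C₂, o ∈ C₁)` (disjoint on `Q`)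
  have hsplit : prob p ((connEvent ends a₁ b ∪ connEvent ends a₂ b) ∩ connEvent ends a₁ o ∩
      (connEvent ends a₁ a₂)ᶜ) =
      prob p (connEvent ends a₁ b ∩ connEvent ends a₁ o ∩ (connEvent ends a₁ a₂)ᶜ) +
        prob p (connEvent ends a₂ b ∩ connEvent ends a₁ o ∩ (connEvent ends a₁ a₂)ᶜ) := by
    rw [← prob_union_of_disjoint p (disjoint_conn_left_right ends a₁ a₂ b _ _)]
    congr 1
    ext ω
    simp only [Set.mem_inter_iff, Set.mem_union]
    tauto
  -- `P(Q, b ∈ C₂, o ∈ U) = P(Q, b ∈ C₂, o ∈ C₁) + P(Q, b ∈ C₂, o ∈ C₂)` (disjoint on `Q`)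
  have hsplit' : prob p (connEvent ends a₂ b ∩ (connEvent ends a₁ o ∪ connEvent ends a₂ o) ∩
      (connEvent ends a₁ a₂)ᶜ) =
      prob p (connEvent ends a₂ b ∩ connEvent ends a₁ o ∩ (connEvent ends a₁ a₂)ᶜ) +
        prob p (connEvent ends a₂ b ∩ connEvent ends a₂ o ∩ (connEvent ends a₁ a₂)ᶜ) := by
    have hd : Disjoint (connEvent ends a₂ b ∩ connEvent ends a₁ o ∩ (connEvent ends a₁ a₂)ᶜ)
        (connEvent ends a₂ b ∩ connEvent ends a₂ o ∩ (connEvent ends a₁ a₂)ᶜ) := by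
      rw [Set.disjoint_left]
      rintro ω ⟨⟨-, ho1⟩, hQ⟩ ⟨⟨-, ho2⟩, -⟩
      exact hQ (conn_trans ho1 (conn_symm ho2))
    rw [← prob_union_of_disjoint p hd]
    congr 1
    ext ω
    simp only [Set.mem_inter_iff, Set.mem_union]
    tauto
  have hbU : prob p (connEvent ends a₂ b ∩ (connEvent ends a₁ a₂)ᶜ) ≤
      prob p (connEvent ends a₁ b ∩ (connEvent ends a₁ a₂)ᶜ ∪
        connEvent ends a₂ b ∩ (connEvent ends a₁ a₂)ᶜ) :=
    prob_mono hp Set.subset_union_right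
  have h0oL := prob_nonneg hp (connEvent ends a₁ o ∩ (connEvent ends a₁ a₂)ᶜ)
  rw [prob_union_inter_Q p ends a₁ a₂ o, mul_add, hsplit']
  rw [hsplit] at h
  calc prob p (connEvent ends a₂ b ∩ (connEvent ends a₁ a₂)ᶜ) *
          prob p (connEvent ends a₁ o ∩ (connEvent ends a₁ a₂)ᶜ) +
        prob p (connEvent ends a₂ b ∩ (connEvent ends a₁ a₂)ᶜ) *
          prob p (connEvent ends a₂ o ∩ (connEvent ends a₁ a₂)ᶜ)
      ≤ prob p (connEvent ends a₁ b ∩ (connEvent ends a₁ a₂)ᶜ ∪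
            connEvent ends a₂ b ∩ (connEvent ends a₁ a₂)ᶜ) *
          prob p (connEvent ends a₁ o ∩ (connEvent ends a₁ a₂)ᶜ) +
        prob p (connEvent ends a₂ b ∩ (connEvent ends a₁ a₂)ᶜ) *
          prob p (connEvent ends a₂ o ∩ (connEvent ends a₁ a₂)ᶜ) :=
        add_le_add (mul_le_mul_of_nonneg_right hbU h0oL) le_rfl
    _ ≤ prob p (connEvent ends a₁ a₂)ᶜ *
          (prob p (connEvent ends a₁ b ∩ connEvent ends a₁ o ∩ (connEvent ends a₁ a₂)ᶜ) +
            prob p (connEvent ends a₂ b ∩ connEvent ends a₁ o ∩ (connEvent ends a₁ a₂)ᶜ) +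
            prob p (connEvent ends a₂ b ∩ connEvent ends a₂ o ∩ (connEvent ends a₁ a₂)ᶜ)) := h
    _ = prob p (connEvent ends a₁ a₂)ᶜ *
          (prob p (connEvent ends a₂ b ∩ connEvent ends a₁ o ∩ (connEvent ends a₁ a₂)ᶜ) +
            prob p (connEvent ends a₂ b ∩ connEvent ends a₂ o ∩ (connEvent ends a₁ a₂)ᶜ) +
            prob p (connEvent ends a₁ b ∩ connEvent ends a₁ o ∩ (connEvent ends a₁ a₂)ᶜ)) := by ring

end Tri

end RowC1

end Summit.Ventures.PercRepro2
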